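import Mathlib
import HarnessLib
import Literature.Analysis.FluidPDE.HardSpherePhaseSpace
import Literature.MathematicalPhysics.KineticTheory.HardSphereEuler
import Summits.AtomisticToContinuum.HydrodynamicLimit.Theses.RelayRaceLocality

/-!
# Energy share at a hard-sphere collision with a partner at rest (`RelayRaceLocality.GibbsLightCone`,
stmt-AtomisticToContinuum-12501, helper `--supports`)

The kinematic kernel of the focusing-relay audit (route card LR-G audit T9; `Cruxes/GibbsLightCone/Disproof.lean`
§C; crux idea card `dilute-hyperbolic-freshness`, first lemma (a), typed as `IdeatorFive.EnergyShareIdentity` in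
`Cruxes/GibbsLightCone/IdeatorFiveSketch.lean`): for the tree's reflection law `reflectVel n (v, w)`
(`v' = v - (⟪v - w, n⟫/‖n‖²) n`, `w' = w + (⟪v - w, n⟫/‖n‖²) n`) with unnormalised contact direction
`n ≠ 0` and a partner at rest (`w = 0`), the partner receives exactly the NORMAL share `⟪v, n⟫² / ‖n‖²`
of `‖v‖²` and the carrier keeps the tangential share `‖v‖² - ⟪v, n⟫² / ‖n‖²`: the retained energy
fraction is `U = 1 - cos²(incidence) = (b/ε)²` (`b` the impact offset), uniform on `[0, 1]` under the
flux-uniform law of `b²`, whence the Biggins drift `inf_s log(2/(s+1))/s = -0.23 < 0` of the hottest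
relay lineage (Disproof §C). Stated over a general real inner-product space; the crux uses `V3`.

Pure algebra (`real_inner_self_eq_norm_sq`, `inner_smul_right`); nothing here is specific to hard spheres
beyond the reflection law. The last theorem is the typed sheet statement `EnergyShareIdentity` verbatim
(specialised to `V3`), so a later line importing this file discharges that first lemma by name.
-/

namespace Summit.AtomisticToContinuum.HydrodynamicLimit.Theorems.DiluteHyperbolicFreshness

open Literature.Analysis.FluidPDE
open Literature.MathematicalPhysics.KineticTheory (V3)
open scoped InnerProductSpace

variable {E : Type*} [NormedAddCommGroup E] [InnerProductSpace ℝ E]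

/-- The velocity received by a partner at rest: `(reflectVel n (v, 0)).2 = (⟪v, n⟫ / ‖n‖²) • n`
(the normal component of `v` along `n`). [folklore] -/
theorem reflectVel_snd_of_rest (n v : E) :
    (reflectVel n (v, (0 : E))).2 = (⟪v, n⟫_ℝ / ‖n‖ ^ 2) • n := by
  simp [reflectVel]

/-- The velocity kept by the carrier against a partner at rest:
`(reflectVel n (v, 0)).1 = v - (⟪v, n⟫ / ‖n‖²) • n` (the tangential component). [folklore] -/
theorem reflectVel_fst_of_rest (n v : E) :
    (reflectVel n (v, (0 : E))).1 = v - (⟪v, n⟫_ℝ / ‖n‖ ^ 2) • n := by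
  simp [reflectVel]

/-- ENERGY SHARE, partner: against a partner at rest the partner receives exactly the normal share
`⟪v, n⟫² / ‖n‖²` of `‖v‖²` (`n ≠ 0`). [folklore] -/
theorem norm_sq_reflectVel_snd_of_rest {n : E} (hn : n ≠ 0) (v : E) :
    ‖(reflectVel n (v, (0 : E))).2‖ ^ 2 = ⟪v, n⟫_ℝ ^ 2 / ‖n‖ ^ 2 := by
  have hn' : ‖n‖ ≠ 0 := norm_ne_zero_iff.2 hn
  rw [reflectVel_snd_of_rest, norm_smul, Real.norm_eq_abs, mul_pow, sq_abs]
  field_simp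

/-- ENERGY SHARE, carrier: against a partner at rest the carrier keeps the tangential share
`‖v‖² - ⟪v, n⟫² / ‖n‖²` (`n ≠ 0`; energy conservation `norm_sq_reflectVel_fst_add_norm_sq_reflectVel_snd`
minus the partner's share). [folklore] -/
theorem norm_sq_reflectVel_fst_of_rest {n : E} (hn : n ≠ 0) (v : E) :
    ‖(reflectVel n (v, (0 : E))).1‖ ^ 2 = ‖v‖ ^ 2 - ⟪v, n⟫_ℝ ^ 2 / ‖n‖ ^ 2 := by
  have h := norm_sq_reflectVel_fst_add_norm_sq_reflectVel_snd n (v, (0 : E))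
  rw [norm_sq_reflectVel_snd_of_rest hn] at h
  simp only [norm_zero, ne_eq, OfNat.ofNat_ne_zero, not_false_eq_true, zero_pow, add_zero] at h
  linarith

/-- The retained energy FRACTION of the carrier is `1 - ⟪v, n⟫² / (‖n‖² ‖v‖²) ∈ [0, 1]`: for `v ≠ 0`,
`‖v'‖² / ‖v‖² = 1 - cos²(incidence)` — the `U = (b/ε)²` of the focusing-relay audit. [folklore] -/
theorem norm_sq_reflectVel_fst_div_of_rest {n : E} (hn : n ≠ 0) {v : E} (hv : v ≠ 0) :
    ‖(reflectVel n (v, (0 : E))).1‖ ^ 2 / ‖v‖ ^ 2 = 1 - ⟪v, n⟫_ℝ ^ 2 / (‖n‖ ^ 2 * ‖v‖ ^ 2) := by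
  have hv' : ‖v‖ ≠ 0 := norm_ne_zero_iff.2 hv
  have hn' : ‖n‖ ≠ 0 := norm_ne_zero_iff.2 hn
  rw [norm_sq_reflectVel_fst_of_rest hn]
  field_simp

/-- The two shares are complementary fractions of `‖v‖²`: both lie in `[0, ‖v‖²]`
(Cauchy–Schwarz `⟪v, n⟫² ≤ ‖v‖² ‖n‖²`). [folklore] -/
theorem norm_sq_reflectVel_snd_of_rest_le {n : E} (hn : n ≠ 0) (v : E) :
    ‖(reflectVel n (v, (0 : E))).2‖ ^ 2 ≤ ‖v‖ ^ 2 := by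
  rw [norm_sq_reflectVel_snd_of_rest hn, div_le_iff₀ (by positivity)]
  have h := abs_real_inner_le_norm v n
  have h2 : ⟪v, n⟫_ℝ ^ 2 = |⟪v, n⟫_ℝ| ^ 2 := (sq_abs _).symm
  rw [h2, ← mul_pow]
  exact pow_le_pow_left₀ (abs_nonneg _) h 2

/-- `IdeatorFive.EnergyShareIdentity` (crux-ideate r2 k5, card `dilute-hyperbolic-freshness`, first lemma
(a)) verbatim over `V3`: the partner's share is `⟪v,n⟫²/‖n‖²` and the carrier's is `‖v‖² - ⟪v,n⟫²/‖n‖²`. [folklore] -/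
theorem energyShareIdentity :
    ∀ n v : V3, n ≠ 0 →
      ‖(reflectVel n (v, (0 : V3))).2‖ ^ 2 = ⟪v, n⟫_ℝ ^ 2 / ‖n‖ ^ 2 ∧
      ‖(reflectVel n (v, (0 : V3))).1‖ ^ 2 = ‖v‖ ^ 2 - ⟪v, n⟫_ℝ ^ 2 / ‖n‖ ^ 2 :=
  fun _ v hn => ⟨norm_sq_reflectVel_snd_of_rest hn v, norm_sq_reflectVel_fst_of_rest hn v⟩

end Summit.AtomisticToContinuum.HydrodynamicLimit.Theorems.DiluteHyperbolicFreshness
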